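import Literature.NumberTheory.DiophantineGeometry.GenEllDeFamilyDefectJunction
import Literature.NumberTheory.DiophantineGeometry.FibreConductorSummation
import Literature.NumberTheory.EllipticCurves.HeightsBaseChangeProofs
import Mathlib.RingTheory.Localization.Integral
import HarnessLib

/-!
# [GenEll] Thm. 2.1 on the `D_e` route, family `t_c`: from the coordinate-ring cofactor identity to the
# integer defect modulus (proof-only sequel to `GenEllDeFamilyDefectJunction.lean`)

S. Mochizuki, *Arithmetic elliptic curves in general position*, Math. J. Okayama Univ. **52** (2010),
Prop. 1.6 p. 10 / proof of Thm. 2.1 pp. 12–13 [cite: MochizukiGenEll2010, Prop 1.6 p.10]. Support file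
for `GenEllTwo` (`stmt-ABC-19679`), route variant R-b (findings F2/F3/F-w5d241-1 of the abc-iut cell,
2026-08-26): the divisibility `N_c ∣ ∏_{a∈A} u_a` in the coordinate ring `K[r,s]/(s² − 1 + 4r^{2k+1})`
(abc-iut-w5-d054 / w5-d023, delivered as a POLYNOMIAL COFACTOR IDENTITY
`∏_{a∈A} (s + c·r^{k+2} − a·(rs)) = N_c(r,s)·(H₀(r) + H₁(r)·s)`, `H₀, H₁ ∈ K[X]`, valid at every point of
`D_e` in every commutative `K`-algebra — VERBATIM the conclusion of abc-iut-w5-d054's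
`DeC.exists_prod_fibre_eq_N_mul`) is turned into the hypotheses `hid`/`hg` of
`DeC.toNat_ord_N_le_of_cofactor` with ONE integer `D ≥ 1` (a common denominator of the coefficients of
`H₀, H₁`: `exists_natCast_mul_coeff_isIntegral`, Mathlib `Algebra.IsAlgebraic.exists_integral_multiples`
over `ℤ`), whence `DeC.exists_defect_of_cofactor_polys`: at EVERY finite place `w` of every number field
`L ⊇ K` with `w(2) = w(c) = 1`, `ord⁺_w N_c ≤ Σ_{a∈A} ord⁺_w (t − a) + ord_w D + Σ_{a∈A} (−ord_w a)⁺`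
— no separation, no good reduction, no `hconv`, no integrality of the critical values (their pole
orders are the last, generically vanishing, term). Total defects over any finite set of places:
`Σ_w (ord⁺_w D)·log N(w) ≤ [L:ℚ]·log D` (`sum_toNat_ord_natCast_add_one_mul_logNorm_le`) and
`Σ_w (−ord_w a)⁺·log N(w) ≤ logHeight₁ a` (`sum_toNat_neg_ord_mul_logNorm_le_logHeight₁`) — constants
linear in `[L:ℚ]`, the input `hD` of `FibreConductor.sum_logNorm_le_of_placewise` (abc-iut-w5-d009). Classical; nothing here bears on [IUTchIII] Cor. 3.12.
-/

noncomputable section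

namespace Literature.NumberTheory.DiophantineGeometry.GenEll

open _root_.Polynomial NumberField IsDedekindDomain Height
open Literature.IUT.LogVolume

/-! ## Total defect bounds (constants linear in the degree) -/

section TotalDefect

variable {L : Type*} [Field L] [NumberField L]

/-- **Total defect**: for an integer `D ≥ 1` and any finite set `S` of finite places of `L`,
`Σ_{w∈S} (ord⁺_w D + 1)·log N(w) ≤ [L:ℚ]·log D + Σ_{w∈S} log N(w)` (the first part is at most the
height `logHeight₁ (D : L) = [L:ℚ]·log D` by the product formula). With abc-iut-w5-d009's
`sum_placesOver_logNorm_le` the right side is `≤ [L:ℚ]·(log D + Σ_{p under S} log p)`, a constant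
linear in the degree — the input `hD` of `FibreConductor.sum_logNorm_le_of_placewise`.
[cite: MochizukiGenEll2010, Thm 2.1 proof pp.12-13] -/
theorem sum_toNat_ord_natCast_add_one_mul_logNorm_le (D : ℕ) (hD : D ≠ 0)
    (S : Finset (HeightOneSpectrum (𝓞 L))) :
    ∑ w ∈ S, (((ord L w (D : L)).toNat + 1 : ℕ) : ℝ) * logNorm L w ≤
      (Module.finrank ℚ L : ℝ) * Real.log D + ∑ w ∈ S, logNorm L w := by
  have h1 : ∑ w ∈ S, ((ord L w (D : L)).toNat : ℝ) * logNorm L w ≤ logHeight₁ ((D : L)) :=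
    FibreConductor.sum_toNat_ord_mul_logNorm_le_logHeight₁ (D : L) S
  have h2 : logHeight₁ ((D : L)) = (Module.finrank ℚ L : ℝ) * Real.log D := by
    haveI : NeZero D := ⟨hD⟩
    have e : (D : L) = algebraMap ℚ L (D : ℚ) := by simp
    rw [e, NumberField.logHeight₁_algebraMap, Rat.logHeight₁_natCast]
  have hsplit : ∑ w ∈ S, (((ord L w (D : L)).toNat + 1 : ℕ) : ℝ) * logNorm L w =
      (∑ w ∈ S, ((ord L w (D : L)).toNat : ℝ) * logNorm L w) + ∑ w ∈ S, logNorm L w := by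
    rw [← Finset.sum_add_distrib]
    refine Finset.sum_congr rfl fun w _ => ?_
    push_cast
    ring
  rw [hsplit, ← h2]
  linarith


/-- **Total pole defect of a value**: for `a ≠ 0` and any finite set `S` of finite places of `L`,
`Σ_{w∈S} (−ord_w a)⁺·log N(w) ≤ logHeight₁ a` (the finite part of the height of `a⁻¹`, and
`h(a⁻¹) = h(a)`); for `a` coming from a fixed number field `K` this is `[L:K]·h_K(a)`, linear in the
degree. [cite: MochizukiGenEll2010, Thm 2.1 proof pp.12-13] -/
theorem sum_toNat_neg_ord_mul_logNorm_le_logHeight₁ (a : L) (S : Finset (HeightOneSpectrum (𝓞 L))) :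
    ∑ w ∈ S, ((-ord L w a).toNat : ℝ) * logNorm L w ≤ logHeight₁ a := by
  have h := FibreConductor.sum_toNat_ord_mul_logNorm_le_logHeight₁ a⁻¹ S
  simp only [ord_inv] at h
  rwa [logHeight₁_inv] at h

end TotalDefect

/-! ## Clearing denominators; the integer defect from the polynomial cofactor identity -/

section Adapter

universe u

variable {K : Type u} [Field K] [NumberField K]

/-- Clearing denominators: for two polynomials over a number field `K` there is an integer `D ≥ 1`
such that all coefficients of `D·H₀` and `D·H₁` are algebraic integers (file plumbing).
[cite: MochizukiGenEll2010, Thm 2.1 proof pp.12-13] -/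
theorem exists_natCast_mul_coeff_isIntegral (H₀ H₁ : K[X]) :
    ∃ D : ℕ, D ≠ 0 ∧ (∀ n, IsIntegral ℤ ((D : K) * H₀.coeff n)) ∧
      ∀ n, IsIntegral ℤ ((D : K) * H₁.coeff n) := by
  classical
  haveI : Algebra.IsAlgebraic ℤ K :=
    (IsFractionRing.comap_isAlgebraic_iff (A := ℤ) (K := ℚ) (C := K)).mpr inferInstance
  obtain ⟨y, hy0, hint⟩ := Algebra.IsAlgebraic.exists_integral_multiples ℤ (H₀.coeffs ∪ H₁.coeffs)
  have hyabs : ((y.natAbs : ℕ) : K) = y ∨ ((y.natAbs : ℕ) : K) = -y := by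
    rcases Int.natAbs_eq y with h | h
    · left
      rw [← Int.cast_natCast, ← h]
    · right
      have h' : (y.natAbs : ℤ) = -y := by omega
      rw [← Int.cast_natCast, h', Int.cast_neg]
  have key : ∀ z ∈ H₀.coeffs ∪ H₁.coeffs, IsIntegral ℤ (((y.natAbs : ℕ) : K) * z) := by
    intro z hz
    have h1 : IsIntegral ℤ ((y : K) * z) := by
      have := hint z hz
      rwa [zsmul_eq_mul] at this
    rcases hyabs with h | h
    · rw [h]; exact h1
    · rw [h, neg_mul]; exact h1.neg
  have hcoeff : ∀ (H : K[X]), (∀ z ∈ H.coeffs, IsIntegral ℤ (((y.natAbs : ℕ) : K) * z)) →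
      ∀ n, IsIntegral ℤ (((y.natAbs : ℕ) : K) * H.coeff n) := by
    intro H hH n
    by_cases hn : H.coeff n = 0
    · rw [hn, mul_zero]; exact isIntegral_zero
    · exact hH _ (coeff_mem_coeffs hn)
  refine ⟨y.natAbs, Int.natAbs_ne_zero.mpr hy0,
    hcoeff H₀ fun z hz => key z (Finset.mem_union_left _ hz),
    hcoeff H₁ fun z hz => key z (Finset.mem_union_right _ hz)⟩

variable {L : Type u} [Field L] [NumberField L] [Algebra K L]

omit [NumberField K] in
/-- A polynomial over `K` whose `D`-multiples of coefficients are algebraic integers, evaluated at a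
`w`-integral point of `L ⊇ K` and multiplied by `D`, is `w`-integral (file plumbing).
[cite: MochizukiGenEll2010, Thm 2.1 proof pp.12-13] -/
theorem valuation_natCast_mul_aeval_le_one (w : HeightOneSpectrum (𝓞 L)) {H : K[X]} {D : ℕ}
    (hH : ∀ n, IsIntegral ℤ ((D : K) * H.coeff n)) {r : L} (hr : w.valuation L r ≤ 1) :
    w.valuation L ((D : L) * aeval r H) ≤ 1 := by
  have e : (D : L) * aeval r H = ((C (D : K) * H).map (algebraMap K L)).eval r := by
    rw [Polynomial.map_mul, map_C, map_natCast, eval_mul, eval_C, eval_map_algebraMap]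
  rw [e]
  refine valuation_eval_le_one (w.valuation L) (fun n => ?_) hr
  rw [coeff_map, coeff_C_mul]
  let z : 𝓞 L := ⟨algebraMap K L ((D : K) * H.coeff n), (hH n).algebraMap⟩
  have hz : (z : L) = algebraMap K L ((D : K) * H.coeff n) := rfl
  rw [← hz]
  exact w.valuation_le_one z

/-- **From the coordinate-ring cofactor identity to the integer defect, at every admissible place.**
Let `K` be a number field containing `c` and the finite set `A` (the critical values of `t_c`), and
suppose the COFACTOR IDENTITY `∏_{a∈A} (s + c·r^{k+2} − a·(rs)) = N_c(r,s)·(H₀(r) + s·H₁(r))` holds at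
every point of `D_e` in every number field `L ⊇ K` (`H₀, H₁ ∈ K[X]`; this is the divisibility
`N_c ∣ ∏_a u_a` in the coordinate ring — abc-iut-w5-d054/w5-d023). Then ONE integer `D ≥ 1` works as
defect modulus at EVERY finite place `w` of every `L` at which `2` and `c` are units:
`ord⁺_w N_c ≤ Σ_{a∈A} ord⁺_w (t − a) + ord_w D + Σ_{a∈A} (−ord_w a)⁺` for every point with `N_c ≠ 0`,
`t ∉ A` (the pole term vanishes wherever `A` is integral; total defects: `TotalDefect` section).
[cite: MochizukiGenEll2010, Prop 1.6 p.10] -/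
theorem DeC.exists_defect_of_cofactor_polys (k : ℕ) (c : K) (A : Finset K) (H₀ H₁ : K[X])
    (hH : ∀ (L : Type u) [CommRing L] [Algebra K L] (r s : L),
      s ^ 2 = 1 - 4 * r ^ (2 * k + 1) →
        ∏ a ∈ A, (s + algebraMap K L c * r ^ (k + 2) - algebraMap K L a * (r * s)) =
          (-s ^ 3 + algebraMap K L c * ((k + 1) * r ^ (k + 2) - 2 * r ^ (3 * k + 3))) *
            (aeval r H₀ + aeval r H₁ * s)) :
    ∃ D : ℕ, D ≠ 0 ∧ ∀ (L : Type u) [Field L] [NumberField L] [Algebra K L]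
      (w : HeightOneSpectrum (𝓞 L)), w.valuation L 2 = 1 → w.valuation L (algebraMap K L c) = 1 →
      ∀ (r s t N : L), s ^ 2 = 1 - 4 * r ^ (2 * k + 1) →
        t * (r * s) = s + algebraMap K L c * r ^ (k + 2) →
        N = -s ^ 3 + algebraMap K L c * ((k + 1) * r ^ (k + 2) - 2 * r ^ (3 * k + 3)) → N ≠ 0 →
        (∀ a ∈ A, t ≠ algebraMap K L a) →
        (ord L w N).toNat ≤
          (∑ a ∈ A, (ord L w (t - algebraMap K L a)).toNat) + (ord L w (D : L)).toNat +
            ∑ a ∈ A, (-ord L w (algebraMap K L a)).toNat := by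
  classical
  obtain ⟨D, hD, h₀, h₁⟩ := exists_natCast_mul_coeff_isIntegral H₀ H₁
  refine ⟨D, hD, ?_⟩
  intro L _ _ _ w hv2 hcv r s t N hcurve ht hN hN0 htA
  -- the identity at the point, with `g := D·(H₀(r) + s·H₁(r))`
  let ι : K ↪ L := ⟨algebraMap K L, (algebraMap K L).injective⟩
  have hι : ∀ a, ι a = algebraMap K L a := fun _ => rfl
  have hid : (D : L) * ∏ a ∈ A.map ι, (s + algebraMap K L c * r ^ (k + 2) - a * (r * s)) =
      ((D : L) * (aeval r H₀ + s * aeval r H₁)) * N := by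
    rw [Finset.prod_map]
    simp only [hι]
    rw [hH L r s hcurve, hN]; ring
  have hg : w.valuation L r ≤ 1 → w.valuation L ((D : L) * (aeval r H₀ + s * aeval r H₁)) ≤ 1 := by
    intro hr
    have hs : w.valuation L s ≤ 1 :=
      DeC.valuation_s_le_one_of_valuation_r_le_one (w.valuation L) k hcurve hr
    have e : (D : L) * (aeval r H₀ + s * aeval r H₁) =
        (D : L) * aeval r H₀ + s * ((D : L) * aeval r H₁) := by ring
    rw [e]
    refine (w.valuation L).map_add_le (valuation_natCast_mul_aeval_le_one w h₀ hr) ?_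
    rw [map_mul]
    exact mul_le_one' hs (valuation_natCast_mul_aeval_le_one w h₁ hr)
  have hmain := DeC.toNat_ord_N_le_of_cofactor' w k hv2 hcv hcurve ht hN hN0 (A.map ι)
    (fun a ha => by
      obtain ⟨a', ha', rfl⟩ := Finset.mem_map.mp ha
      exact htA a' ha')
    D hD _ hid hg
  rw [Finset.sum_map, Finset.sum_map] at hmain
  simpa only [hι] using hmain

end Adapter

end Literature.NumberTheory.DiophantineGeometry.GenEll

end
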